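import Summits.RiemannHypothesis.RiemannHypothesis.Theorems.LiCoefficientsLiFarZeroTail
import Summits.RiemannHypothesis.RiemannHypothesis.Theorems.LiCoefficientsLiHeightBudget
import Summits.RiemannHypothesis.RiemannHypothesis.Theorems.LiCoefficientsLiBoxSplitPair
import Summits.RiemannHypothesis.RiemannHypothesis.Theorems.LiCoefficientsLiWindowIdentity
import Summits.RiemannHypothesis.RiemannHypothesis.Theorems.LiCoefficientsLiWindowOscillatory
import Summits.RiemannHypothesis.RiemannHypothesis.Theorems.LiCoefficientsLiWindowTuring
import HarnessLib

/-!
# RiemannHypothesis / LiCoefficients — the rung leaf L-P(P1): the Li HEIGHT LAW, quadratic range (RH-FREE)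

`liHeightLawQuadratic_holds : LiTheory.LiHeightLawQuadratic` — if every zero of `ζ` with `0 < Im ρ ≤ T` (`T ≥ 10⁵`)
lies on the critical line, then `λ_n = keiperLiCoeff n ≥ 0` for every `1 ≤ n ≤ T²/5`.  Route
`RiemannHypothesis/LiCoefficients` (cell `pub/rh-li`, D-0059/D-0061; theory memo `theory/TARGETS.md` §8.1).  This file:

* `BoxSplit.re_boxSum_ge`, `liBoxSplit_bound` — crux `LiBoxSplit` (L5): for RH verified to `T`, `1100 ≤ T₂ ≤ T`,
  `1 ≤ n ≤ T²/4` and any bound `B` of the far tails: `λ_n ≥ 2 ∑_{T₂/2 < Im ρ ≤ T₂} m(ρ) f_n(Im ρ) − 2.82 n² B`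
  (`λ_n = lim Re ∑_{liZeroBox T'}`, `keiperLiCoeff_eq_zero_sum_holds`; symmetrise under `ρ ↦ 1 − ρ̄`; on-line pair term
  `2 m f_n(γ) ≥ 0`, far pair term `≥ −2.82 n² m/γ⁴`; lemmas L1/L2 in `LiCoefficientsLiBoxSplitPair.lean`);
* `liWindowLowerBound_bound` — crux `LiWindowLowerBound` (L4): `∑_{T₂/2 < Im ρ ≤ T₂} m f_n(Im ρ) ≥ liWindowBound n T₂`
  (`T₂ ≥ 1100`), the linarith-composition of S1/S2/S4 (`LiCoefficientsLiWindowIdentity.lean`), S3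
  (`LiCoefficientsLiWindowOscillatory.lean`), S5 (`LiCoefficientsLiWindowTuring.lean`) — the theory seat's skeleton;
* `liHeightLawQuadratic_holds` — the leaf, assembled (the theory seat's `AssemblyProof.lean`): for `n ≤ 2π(T − 4)` the
  tree's linear law `keiperLiCoeff_nonneg_of_riemannHypothesisUpTo`; otherwise `T₂ = min(T, n/13)`, `B = log T/(6πT³)`
  (`liFarZeroTail_bound`), and the budget `liHeightBudget_bound`; corollaries `liHeightLawQuadraticCrude_holds` and
  `liPositivityPlattTrudgian24_holds` (`λ_n ≥ 0` for `1 ≤ n ≤ 1.8·10²⁴` at the Platt–Trudgian height; the kernel's previous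
  range was `1.885·10¹³`, `keiperLiCoeff_nonneg_of_plattTrudgian`).

RH-FREE [rh-li-prover]: the hypothesis is a finite verified height, the conclusion finitely many signs; part of the
PROOF-OF-DATA rung L-P(P1) of the RH ladder's column LI; nothing here bears on the truth of RH.  In print Brown 2005
Thm 2 (`n ≤ 2T² log T`) has no complete proof (Droll 2012 Conj. 1.7.10; Palojärvi 2020 §1) and Oesterlé's `n ≤ T²` is
unpublished — see the docstrings of `LiCoefficientsDefs.lean`.
-/

noncomputable section

-- D-0017: `Summit.<S>.<S>.…` is the designed namespace of a single-problem summit.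
set_option linter.dupNamespace false

open Complex Filter Set
open scoped Real ComplexConjugate Topology

namespace Summit.RiemannHypothesis.RiemannHypothesis.Theorems.LiTheory


open Literature.NumberTheory.LFunctions Literature.NumberTheory.LFunctions.SchoenfeldBound
open Literature.NumberTheory.DiophantineGeometry

namespace BoxSplit

/-- **Box bookkeeping.**  For RH verified to `T`, `0 < T₂ ≤ T`, `4 ≤ T`, `n ≤ T²/4` and `T' ≥ T`:
`2 ∑_{T₂/2 < Im ρ ≤ T₂} m f_n(Im ρ) − 2.82 n² ∑_{T < Im ρ ≤ T'} m/(Im ρ)⁴ ≤ Re ∑_{ρ ∈ liZeroBox T'} m(ρ)(1 − (1 − 1/ρ)ⁿ)`. -/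
theorem re_boxSum_ge {n : ℕ} {T T₂ T' : ℝ} (hRH : RiemannHypothesisUpTo T) (hT₂0 : 0 < T₂)
    (hT₂T : T₂ ≤ T) (hT4 : 4 ≤ T) (hn4 : (n : ℝ) ≤ T ^ 2 / 4) (hTT' : T ≤ T') :
    2 * (∑ ρ ∈ zerosBetween (T₂ / 2) T₂, (riemannZetaZeroOrder ρ : ℝ) * liWindowWeight n ρ.im)
        - 2.82 * (n : ℝ) ^ 2 *
          ∑ ρ ∈ zerosBetween T T', (riemannZetaZeroOrder ρ : ℝ) / ρ.im ^ 4 ≤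
      (∑ᶠ ρ ∈ liZeroBox T', (riemannZetaZeroOrder ρ : ℂ) * (1 - (1 - 1 / ρ) ^ n)).re := by
  classical
  rw [finsum_mem_eq_finite_toFinset_sum _ (liZeroBox_finite T'), Complex.re_sum]
  set B := (liZeroBox_finite T').toFinset with hB
  have hmem : ∀ ρ, ρ ∈ B ↔ ρ ∈ liZeroBox T' := fun ρ ↦ Set.Finite.mem_toFinset _
  set f : ℂ → ℝ := fun ρ ↦ ((riemannZetaZeroOrder ρ : ℂ) * (1 - (1 - 1 / ρ) ^ n)).re with hf
  have hfval : ∀ ρ : ℂ, f ρ = (riemannZetaZeroOrder ρ : ℝ) * (1 - (1 - 1 / ρ) ^ n).re := by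
    intro ρ
    simp only [hf, Complex.mul_re, Complex.intCast_re, Complex.intCast_im, zero_mul, sub_zero]
  -- reflection reindexing
  have hσmem : ∀ ρ ∈ B, 1 - conj ρ ∈ B :=
    fun ρ hρ ↦ (hmem _).2 (one_sub_conj_mem_liZeroBox ((hmem ρ).1 hρ))
  have hσσ : ∀ ρ : ℂ, 1 - conj (1 - conj ρ) = ρ := fun ρ ↦ by simp
  have hreindex : ∑ ρ ∈ B, f (1 - conj ρ) = ∑ ρ ∈ B, f ρ :=
    Finset.sum_nbij' (fun ρ ↦ 1 - conj ρ) (fun ρ ↦ 1 - conj ρ) hσmem hσmem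
      (fun ρ _ ↦ hσσ ρ) (fun ρ _ ↦ hσσ ρ) fun _ _ ↦ rfl
  have h2 : 2 * ∑ ρ ∈ B, f ρ = ∑ ρ ∈ B, (f ρ + f (1 - conj ρ)) := by
    rw [Finset.sum_add_distrib, hreindex, two_mul]
  -- facts about members of the box
  have hfacts : ∀ ρ ∈ B, riemannZeta ρ = 0 ∧ 0 ≤ ρ.re ∧ ρ.re ≤ 1 ∧ 0 < |ρ.im| ∧ |ρ.im| ≤ T' ∧
      ρ.im ≠ 0 ∧ (0 : ℝ) ≤ riemannZetaZeroOrder ρ ∧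
      riemannZetaZeroOrder (1 - conj ρ) = riemannZetaZeroOrder ρ := by
    intro ρ hρ
    obtain ⟨hz, h0, h1, him, hT'⟩ := (hmem ρ).1 hρ
    have him0 : ρ.im ≠ 0 := abs_pos.1 him
    have hρ1 : ρ ≠ 1 := fun h ↦ him0 (by simp [h])
    have hre_pos : 0 < ρ.re := re_pos_of_riemannZeta_eq_zero hz him0
    have hre_lt : ρ.re < 1 :=
      lt_of_le_of_ne h1 fun h ↦ riemannZeta_ne_zero_of_one_le_re (le_of_eq h.symm) hz
    exact ⟨hz, h0, h1, him, hT', him0, by exact_mod_cast ((riemannZetaZeroOrder_pos_iff hρ1).2 hz).le,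
      riemannZetaZeroOrder_one_sub_conj hre_pos hre_lt⟩
  -- split the box at height `T`
  set Blow := B.filter (fun ρ ↦ |ρ.im| ≤ T) with hBlow
  set Bhigh := B.filter (fun ρ ↦ ¬ |ρ.im| ≤ T) with hBhigh
  have hsplit : ∑ ρ ∈ B, (f ρ + f (1 - conj ρ)) =
      ∑ ρ ∈ Blow, (f ρ + f (1 - conj ρ)) + ∑ ρ ∈ Bhigh, (f ρ + f (1 - conj ρ)) :=
    (Finset.sum_filter_add_sum_filter_not B _ _).symm
  -- (a) the verified part: pair term `= 2 m f_n(γ) ≥ 0`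
  have hlow_term : ∀ ρ ∈ Blow, f ρ + f (1 - conj ρ) =
      2 * ((riemannZetaZeroOrder ρ : ℝ) * liWindowWeight n ρ.im) := by
    intro ρ hρ
    rw [Finset.mem_filter] at hρ
    obtain ⟨hz, -, -, -, -, him0, -, -⟩ := hfacts ρ hρ.1
    have hre : ρ.re = 1 / 2 := re_eq_half_of_riemannHypothesisUpTo hRH hz him0 hρ.2
    have hσ : 1 - conj ρ = ρ := by
      apply Complex.ext
      · simp only [sub_re, one_re, conj_re, hre]; norm_num
      · simp
    rw [hσ, hfval, re_one_sub_pow_onLine n hre him0]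
    ring
  have hw_nonneg : ∀ ρ ∈ Blow, 0 ≤ (riemannZetaZeroOrder ρ : ℝ) * liWindowWeight n ρ.im := by
    intro ρ hρ
    rw [Finset.mem_filter] at hρ
    obtain ⟨-, -, -, -, -, -, hm, -⟩ := hfacts ρ hρ.1
    refine mul_nonneg hm ?_
    unfold liWindowWeight
    linarith [Real.cos_le_one (n * liZeroAngle ρ.im)]
  set S := zerosBetween (T₂ / 2) T₂ with hS
  have hT₂2 : (0 : ℝ) ≤ T₂ / 2 := by linarith
  have hSsub : S ⊆ Blow := by
    intro ρ hρ
    obtain ⟨hz, h0, h1, h3, h4⟩ := (mem_zerosBetween hT₂2).1 hρ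
    have hpos : 0 < ρ.im := by linarith
    rw [Finset.mem_filter, hmem, abs_of_pos hpos]
    exact ⟨⟨hz, h0, h1, by rwa [abs_of_pos hpos], by rw [abs_of_pos hpos]; linarith⟩, by linarith⟩
  have hS'sub : S.image conj ⊆ Blow := by
    intro ρ' hρ'
    obtain ⟨ρ, hρ, rfl⟩ := Finset.mem_image.1 hρ'
    obtain ⟨hbox, habs⟩ := conj_mem_of_mem_zerosBetween hT₂2 (by linarith : T₂ ≤ T') hρ
    obtain ⟨-, -, -, -, h4⟩ := (mem_zerosBetween hT₂2).1 hρ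
    rw [Finset.mem_filter, hmem, habs]
    exact ⟨hbox, by linarith⟩
  have hdisj : Disjoint S (S.image conj) := by
    rw [Finset.disjoint_left]
    intro ρ hρ hρ'
    obtain ⟨ρ₀, hρ₀, he⟩ := Finset.mem_image.1 hρ'
    obtain ⟨-, -, -, h3, -⟩ := (mem_zerosBetween hT₂2).1 hρ
    obtain ⟨-, -, -, h3', -⟩ := (mem_zerosBetween hT₂2).1 hρ₀
    have : ρ.im = -ρ₀.im := by rw [← he, Complex.conj_im]
    linarith
  have hconj_inj : Set.InjOn (conj : ℂ → ℂ) S := fun x _ y _ h ↦ by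
    simpa using congrArg conj h
  have hSimage : ∑ ρ ∈ S.image conj, (riemannZetaZeroOrder ρ : ℝ) * liWindowWeight n ρ.im =
      ∑ ρ ∈ S, (riemannZetaZeroOrder ρ : ℝ) * liWindowWeight n ρ.im := by
    rw [Finset.sum_image hconj_inj]
    refine Finset.sum_congr rfl fun ρ _ ↦ ?_
    rw [riemannZetaZeroOrder_conj_holds ρ, Complex.conj_im, liWindowWeight_neg]
  have hlow : 2 * (2 * ∑ ρ ∈ S, (riemannZetaZeroOrder ρ : ℝ) * liWindowWeight n ρ.im) ≤
      ∑ ρ ∈ Blow, (f ρ + f (1 - conj ρ)) := by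
    rw [Finset.sum_congr rfl hlow_term, ← Finset.mul_sum]
    refine mul_le_mul_of_nonneg_left ?_ (by norm_num)
    have hU : S ∪ S.image conj ⊆ Blow := Finset.union_subset hSsub hS'sub
    calc 2 * ∑ ρ ∈ S, (riemannZetaZeroOrder ρ : ℝ) * liWindowWeight n ρ.im
        = ∑ ρ ∈ S ∪ S.image conj, (riemannZetaZeroOrder ρ : ℝ) * liWindowWeight n ρ.im := by
          rw [Finset.sum_union hdisj, hSimage, two_mul]
      _ ≤ ∑ ρ ∈ Blow, (riemannZetaZeroOrder ρ : ℝ) * liWindowWeight n ρ.im :=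
          Finset.sum_le_sum_of_subset_of_nonneg hU fun ρ hρ _ ↦ hw_nonneg ρ hρ
  -- (b) the far part: pair term `≥ −2.82 n² m/γ⁴`
  have hT0 : (0 : ℝ) ≤ T := by linarith
  have hhigh_term : ∀ ρ ∈ Bhigh,
      -(2.82 * (n : ℝ) ^ 2) * ((riemannZetaZeroOrder ρ : ℝ) / ρ.im ^ 4) ≤ f ρ + f (1 - conj ρ) := by
    intro ρ hρ
    rw [Finset.mem_filter, not_le] at hρ
    obtain ⟨hz, h0, h1, him, -, him0, hm, hmσ⟩ := hfacts ρ hρ.1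
    have hγnorm : |ρ.im| ≤ ‖ρ‖ := Complex.abs_im_le_norm ρ
    have hnorm4 : (4 : ℝ) ≤ ‖ρ‖ := by linarith [hρ.2]
    have hT2 : T ^ 2 ≤ ‖ρ‖ ^ 2 := by nlinarith [hρ.2]
    have hn' : (n : ℝ) ≤ ‖ρ‖ ^ 2 / 4 := by linarith
    have hpair := far_pair_lower n h0 h1 hnorm4 hn'
    have him2 : ρ.im ^ 2 ≤ ‖ρ‖ ^ 2 := by nlinarith [sq_abs ρ.im, abs_nonneg ρ.im]
    have h4 : ρ.im ^ 4 ≤ ‖ρ‖ ^ 4 := by nlinarith [sq_nonneg ρ.im]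
    have hγ4pos : 0 < ρ.im ^ 4 := by positivity
    have hfrac : 2.82 * (n : ℝ) ^ 2 / ‖ρ‖ ^ 4 ≤ 2.82 * (n : ℝ) ^ 2 / ρ.im ^ 4 :=
      div_le_div_of_nonneg_left (by positivity) hγ4pos h4
    rw [hfval, hfval, hmσ, ← mul_add]
    have := mul_le_mul_of_nonneg_left (le_trans (neg_le_neg hfrac) hpair) hm
    have hrew : -(2.82 * (n : ℝ) ^ 2) * ((riemannZetaZeroOrder ρ : ℝ) / ρ.im ^ 4) =
        (riemannZetaZeroOrder ρ : ℝ) * (-(2.82 * (n : ℝ) ^ 2 / ρ.im ^ 4)) := by ring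
    rw [hrew]
    exact this
  set S₁ := zerosBetween T T' with hS₁
  have hcover : Bhigh ⊆ S₁ ∪ S₁.image conj := by
    intro ρ hρ
    rw [Finset.mem_filter, not_le] at hρ
    obtain ⟨hz, h0, h1, -, hT', him0, -, -⟩ := hfacts ρ hρ.1
    rw [Finset.mem_union]
    rcases lt_or_gt_of_ne him0 with hneg | hpos
    · right
      rw [Finset.mem_image]
      refine ⟨conj ρ, (mem_zerosBetween hT0).2 ⟨by rw [riemannZeta_conj, hz, map_zero], by simpa using h0,
        by simpa using h1, ?_, ?_⟩, by simp⟩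
      · rw [Complex.conj_im]; rw [abs_of_neg hneg] at hρ; exact hρ.2
      · rw [Complex.conj_im]; rw [abs_of_neg hneg] at hT'; exact hT'
    · left
      rw [abs_of_pos hpos] at hρ hT'
      exact (mem_zerosBetween hT0).2 ⟨hz, h0, h1, hρ.2, hT'⟩
  have hdisj₁ : Disjoint S₁ (S₁.image conj) := by
    rw [Finset.disjoint_left]
    intro ρ hρ hρ'
    obtain ⟨ρ₀, hρ₀, he⟩ := Finset.mem_image.1 hρ'
    obtain ⟨-, -, -, h3, -⟩ := (mem_zerosBetween hT0).1 hρ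
    obtain ⟨-, -, -, h3', -⟩ := (mem_zerosBetween hT0).1 hρ₀
    have : ρ.im = -ρ₀.im := by rw [← he, Complex.conj_im]
    linarith
  have hconj_inj₁ : Set.InjOn (conj : ℂ → ℂ) S₁ := fun x _ y _ h ↦ by
    simpa using congrArg conj h
  have hq_nonneg : ∀ ρ ∈ S₁ ∪ S₁.image conj, 0 ≤ (riemannZetaZeroOrder ρ : ℝ) / ρ.im ^ 4 := by
    intro ρ hρ
    rcases Finset.mem_union.1 hρ with h | h
    · exact div_nonneg (zeroOrder_nonneg_of_mem_zerosBetween hT0 h) (by positivity)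
    · obtain ⟨ρ₀, hρ₀, rfl⟩ := Finset.mem_image.1 h
      rw [riemannZetaZeroOrder_conj_holds ρ₀]
      exact div_nonneg (zeroOrder_nonneg_of_mem_zerosBetween hT0 hρ₀) (by positivity)
  have hS₁image : ∑ ρ ∈ S₁.image conj, (riemannZetaZeroOrder ρ : ℝ) / ρ.im ^ 4 =
      ∑ ρ ∈ S₁, (riemannZetaZeroOrder ρ : ℝ) / ρ.im ^ 4 := by
    rw [Finset.sum_image hconj_inj₁]
    refine Finset.sum_congr rfl fun ρ _ ↦ ?_
    rw [riemannZetaZeroOrder_conj_holds ρ, Complex.conj_im, neg_pow, show ((-1 : ℝ)) ^ 4 = 1 by norm_num,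
      one_mul]
  have hhigh_sum : ∑ ρ ∈ Bhigh, (riemannZetaZeroOrder ρ : ℝ) / ρ.im ^ 4 ≤
      2 * ∑ ρ ∈ S₁, (riemannZetaZeroOrder ρ : ℝ) / ρ.im ^ 4 :=
    calc ∑ ρ ∈ Bhigh, (riemannZetaZeroOrder ρ : ℝ) / ρ.im ^ 4
        ≤ ∑ ρ ∈ S₁ ∪ S₁.image conj, (riemannZetaZeroOrder ρ : ℝ) / ρ.im ^ 4 :=
          Finset.sum_le_sum_of_subset_of_nonneg hcover fun ρ hρ _ ↦ hq_nonneg ρ hρ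
      _ = 2 * ∑ ρ ∈ S₁, (riemannZetaZeroOrder ρ : ℝ) / ρ.im ^ 4 := by
          rw [Finset.sum_union hdisj₁, hS₁image, two_mul]
  have hhigh : -(2.82 * (n : ℝ) ^ 2) * (2 * ∑ ρ ∈ S₁, (riemannZetaZeroOrder ρ : ℝ) / ρ.im ^ 4) ≤
      ∑ ρ ∈ Bhigh, (f ρ + f (1 - conj ρ)) := by
    have h1 := Finset.sum_le_sum hhigh_term
    rw [← Finset.mul_sum] at h1
    have hn2 : (0 : ℝ) ≤ 2.82 * (n : ℝ) ^ 2 := by positivity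
    nlinarith
  -- combine
  have htotal : 2 * (2 * ∑ ρ ∈ S, (riemannZetaZeroOrder ρ : ℝ) * liWindowWeight n ρ.im)
      + -(2.82 * (n : ℝ) ^ 2) * (2 * ∑ ρ ∈ S₁, (riemannZetaZeroOrder ρ : ℝ) / ρ.im ^ 4) ≤
      2 * ∑ ρ ∈ B, f ρ := by
    rw [h2, hsplit]; exact add_le_add hlow hhigh
  linarith

end BoxSplit

open BoxSplit

/-- **Crux `LiBoxSplit` (L5, the Bombieri–Lagarias box sum split; RH-free apart from the verified height).**
For RH verified to `T`, `1100 ≤ T₂ ≤ T`, `1 ≤ n ≤ T²/4` and any bound `B` on the far tails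
`∑_{T < Im ρ ≤ U} m(ρ)/(Im ρ)⁴` (all `U ≥ T`):
`λ_n ≥ 2 ∑_{T₂/2 < Im ρ ≤ T₂} m(ρ) f_n(Im ρ) − 2.82 n² B` (`keiperLiCoeff_eq_zero_sum_holds` + `re_boxSum_ge`
in the symmetric limit `T' → ∞`). -/
theorem liBoxSplit_bound :
    ∀ (n : ℕ) (T T₂ B : ℝ), Literature.NumberTheory.DiophantineGeometry.RiemannHypothesisUpTo T →
      1100 ≤ T₂ → T₂ ≤ T → 1 ≤ n → (n : ℝ) ≤ T ^ 2 / 4 →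
      (∀ U : ℝ, T ≤ U → ∑ ρ ∈ Literature.NumberTheory.LFunctions.SchoenfeldBound.zerosBetween T U,
          (Literature.NumberTheory.LFunctions.riemannZetaZeroOrder ρ : ℝ) / ρ.im ^ 4 ≤ B) →
        2 * (∑ ρ ∈ Literature.NumberTheory.LFunctions.SchoenfeldBound.zerosBetween (T₂ / 2) T₂,
              (Literature.NumberTheory.LFunctions.riemannZetaZeroOrder ρ : ℝ) *
                Summit.RiemannHypothesis.RiemannHypothesis.Theorems.LiTheory.liWindowWeight n ρ.im)
          - 2.82 * (n : ℝ) ^ 2 * B ≤ Literature.NumberTheory.LFunctions.keiperLiCoeff n := by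
  intro n T T₂ B hRH hT₂ hT₂T hn hn4 hB
  have H := (Complex.continuous_re.tendsto _).comp (keiperLiCoeff_eq_zero_sum_holds n hn)
  simp only [Complex.ofReal_re] at H
  refine ge_of_tendsto H ?_
  filter_upwards [Filter.eventually_ge_atTop T] with T' hTT'
  simp only [Function.comp_apply]
  have hbox := re_boxSum_ge (n := n) hRH (by linarith) hT₂T (by linarith) hn4 hTT'
  have hBT := hB T' hTT'
  have hn2 : (0 : ℝ) ≤ 2.82 * (n : ℝ) ^ 2 := by positivity
  nlinarith

/-! ### Crux `LiWindowLowerBound`: the composition -/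



/-- **Crux `LiWindowLowerBound`.**  For `n ≥ 1` and `T₂ ≥ 1100`:
`liWindowBound n T₂ ≤ ∑_{T₂/2 < Im ρ ≤ T₂} m(ρ) f_n(Im ρ)`. -/
theorem liWindowLowerBound_bound :
    ∀ (n : ℕ) (T₂ : ℝ), 1 ≤ n → 1100 ≤ T₂ →
      Summit.RiemannHypothesis.RiemannHypothesis.Theorems.LiTheory.liWindowBound n T₂ ≤
        ∑ ρ ∈ Literature.NumberTheory.LFunctions.SchoenfeldBound.zerosBetween (T₂ / 2) T₂,
          (Literature.NumberTheory.LFunctions.riemannZetaZeroOrder ρ : ℝ) *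
            Summit.RiemannHypothesis.RiemannHypothesis.Theorems.LiTheory.liWindowWeight n ρ.im := by
  intro n T₂ hn hT₂
  have ha : (0 : ℝ) < T₂ / 2 := by linarith
  have hid := Window.windowIdentity ha.le (by linarith : T₂ / 2 ≤ T₂)
    (f := liWindowWeight n) (f' := liWindowWeightDeriv n)
    (fun t ht ↦ hasDerivAt_liWindowWeight n (ne_of_gt (lt_of_lt_of_le ha ht.1)))
    (continuousOn_liWindowWeightDeriv n ha)
  have h2' := Window.thetaMain hT₂
  have h3' := abs_le.mp (Window.thetaOsc n hn hT₂)
  have h4' := Window.backlundBoundary n hT₂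
  have h5' := abs_le.mp (Window.turingByParts n hT₂)
  have hb1 := neg_abs_le (zetaArgS T₂ * liWindowWeight n T₂)
  have hb2 := le_abs_self (zetaArgS (T₂ / 2) * liWindowWeight n (T₂ / 2))
  rw [hid]
  unfold liWindowBound
  linarith [h3'.1, h3'.2, h5'.1, h5'.2]

/-! ### The leaf -/


/-- **The Li HEIGHT LAW, quadratic range `c = 1/5`, `T₀ = 10⁵` (RH-FREE; leaf L-P(P1) of the RH ladder's column LI).**
If every zero of `ζ` with `0 < Im ρ ≤ T` (`T ≥ 10⁵`) has `Re ρ = ½`, then `keiperLiCoeff n ≥ 0` for all `1 ≤ n ≤ T²/5`. -/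
theorem liHeightLawQuadratic_holds : LiHeightLawQuadratic := by
  intro T hT hRH n hn hnc
  have hπ := Real.pi_gt_three
  have hπ4 := Real.pi_lt_d2
  have hT5 : (10 : ℝ) ^ 5 ≤ T := hT
  have hT0 : (0 : ℝ) < T := by linarith [hT5, show (0:ℝ) < 10 ^ 5 by norm_num]
  by_cases hlin : (n : ℝ) ≤ 2 * Real.pi * (T - 4)
  · exact Literature.NumberTheory.LFunctions.keiperLiCoeff_nonneg_of_riemannHypothesisUpTo hRH hn hlin
  rw [not_le] at hlin
  set T₂ : ℝ := min T (n / 13) with hT₂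
  have hT₂_ge : (1100 : ℝ) ≤ T₂ := by
    rw [hT₂, le_min_iff]; constructor
    · linarith [hT5, show (1100 : ℝ) ≤ 10 ^ 5 by norm_num]
    · rw [le_div_iff₀ (by norm_num : (0 : ℝ) < 13)]
      have : 2 * Real.pi * (T - 4) ≥ 2 * 3 * ((10 : ℝ) ^ 5 - 4) := by nlinarith
      norm_num at this; linarith
  have hT₂_le : T₂ ≤ T := min_le_left _ _
  have hnc4 : (n : ℝ) ≤ T ^ 2 / 4 := hnc.trans (by nlinarith [sq_nonneg T])
  have hB : ∀ U : ℝ, T ≤ U →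
      ∑ ρ ∈ Literature.NumberTheory.LFunctions.SchoenfeldBound.zerosBetween T U,
        (Literature.NumberTheory.LFunctions.riemannZetaZeroOrder ρ : ℝ) / ρ.im ^ 4 ≤
        Real.log T / (6 * Real.pi * T ^ 3) :=
    fun U hU ↦ liFarZeroTail_bound T U (by linarith [hT5, show (1000 : ℝ) ≤ 10 ^ 5 by norm_num]) hU
  have hsplit := liBoxSplit_bound n T T₂ (Real.log T / (6 * Real.pi * T ^ 3)) hRH hT₂_ge hT₂_le hn hnc4 hB
  have hwin := liWindowLowerBound_bound n T₂ hn hT₂_ge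
  have hbud := liHeightBudget_bound n T hT5 hlin hnc
  linarith

/-- The crude first rung (`c = 1/10`, `T₀ = 10⁶`) follows. -/
theorem liHeightLawQuadraticCrude_holds : LiHeightLawQuadraticCrude :=
  liHeightLawQuadraticCrude_of liHeightLawQuadratic_holds

/-- **Corollary at the Platt–Trudgian height** (`T = 3 000 175 332 800`): `λ_n ≥ 0` for every `1 ≤ n ≤ 1.8·10²⁴`. -/
theorem liPositivityPlattTrudgian24_holds : LiPositivityPlattTrudgian24 :=
  liPositivityPlattTrudgian24_of liHeightLawQuadratic_holds

end Summit.RiemannHypothesis.RiemannHypothesis.Theorems.LiTheory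

end
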